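import Literature.Computability.QuantumComplexity.PostBQPAmplification
import Literature.Computability.QuantumComplexity.BPPRelSubsetBQPRel
import Literature.Computability.Complexity.MajorityVoteWeighted
import HarnessLib

/-!
# Polynomially many parallel copies of a uniform quantum circuit family, I: the family and its output law

Topic `Literature/Computability/QuantumComplexity`; infrastructure for the discharge of the named
fact `Literature.Computability.Cryptography.isQSolvable_of_mem_BQP_oracle` (Bennett–Bernstein–
Brassard–Vazirani 1997, Cor. 4.15 `BQP^BQP = BQP`), whose tidy subroutines (Thm. 4.14) are built on
**boosting** (Thm. 4.13: "We will build a machine that runs `k` independent copies of `M` and then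
takes the vote of the `k` answers … when `k = b log 1/ε`, the probability of seeing the correct
answer will be at least `1 − ε`"), with a number of copies that must grow with the precision, i.e.
with the input length of the machine being boosted.

The tree's `PostBQPAmplification.lean` runs a *constant* number `K` of copies (followed by a
unanimity gadget). This file is its variant with a **polynomial number `K(n) = pK(n) + 1` of copies**
and no classical second stage: on inputs of length `n`, on `n + anc n` wires,

  `circ n = stage1 n ++ ⨁_{j < K n} (conjGates n j ++ copyGates n ++ conjGates n j)`,

stage 1 being the compiled fan-out of the input into the input wires of the `K n` blocks
(`prog1`, CNOTs), `conjGates n j` the compiled swap of the front window `[0, b n)` with block `j`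
and `copyGates n` the given circuit `F.circ n` placed verbatim on the front wires (swap–copy–swap
runs the copy on block `j`, `WireConjugation.toMatrix_conj_mapWires`), exactly as there (same
layout up to `base n = b n + 1`, same lemmas, whose proofs are adapted line by line). Proved here:
the layout and the programs, stage 1 on the input (`w1`), the product state after the quantum stage
(`stageQ_mulVec_W1`), the output kernel as the Born sum of that product state
(`kernelProb_family_eq`), the one-block marginals of the answer wire (`sum_filter_blockState_wire0`,
`…_false`), and **`kernelProb_count_ge`**: for every read-out event decided by a strict majority of
correct answer wires, the family outputs a string in the event with probability at least
`1 − 1/(4 K(n) η²)` when one copy is right with probability `≥ 1/2 + η` (the weighted Chebyshev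
bound `sum_majority_fail_mul_le` of `Complexity/MajorityVoteWeighted.lean`). Part IV proves **`family_isUniform`** (generator program for stage 1, counted fold of swap–copy–swap
pieces for the quantum stage, as in `PostBQPAmplification.lean` / `CWrapUniform.lean`). The classical
majority read-out and the amplified decider are in the sequel `PolyMajority.lean`.

## References

* C. H. Bennett, E. Bernstein, G. Brassard, U. Vazirani, *Strengths and weaknesses of quantum
  computing*, SIAM J. Comput. 26 (1997) 1510–1523, Thm. 4.13 and its proof (arXiv:quant-ph/9701001,
  p. 12) [BennettBernsteinBrassardVazirani1997].
* M. A. Nielsen, I. L. Chuang, *Quantum Computation and Quantum Information*, CUP 2010, §1.3.4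
  (swap from three `CNOT`s), §2.1.7 eq. (2.45), §2.2.8, §4.3 [NielsenChuang2010].
* S. Arora, B. Barak, *Computational Complexity: A Modern Approach*, CUP 2009, §10.3.7 Lemma 10.10
  [AroraBarak2009].
-/

noncomputable section

namespace Literature.Computability.QuantumComplexity

namespace PolyCopies

open _root_.Computability Complexity Cryptography RevSim RevMux Function Matrix Finset

/-! ## Part I. Layout and the fan-out program -/

/-- The data of the family (a hypothesis structure): the given family `F`, a polynomial bound `pF`
of its ancilla count, and the polynomial `pK` giving the number of copies `K(n) = pK(n) + 1`.
[cite: BennettBernsteinBrassardVazirani1997, Thm. 4.13 (k copies, k polynomial in log 1/ε)] -/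
structure Params where
  /-- the given family -/
  F : QCircuitFamily cliffordT
  /-- a polynomial bound of its ancilla count -/
  pF : Polynomial ℕ
  /-- the bound -/
  hpF : ∀ n, F.ancillas n ≤ pF.eval n
  /-- the number of copies, minus one, as a polynomial of the input length -/
  pK : Polynomial ℕ

variable (P : Params)

/-! ### Layout -/

/-- The number of copies on inputs of length `n`: `pK(n) + 1 ≥ 1`. [folklore] -/
def K (n : ℕ) : ℕ := P.pK.eval n + 1

/-- The block width (= the width of the front window): `n + pF n + 2`. [folklore] -/
def b (n : ℕ) : ℕ := n + P.pF.eval n + 2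

/-- The first wire of the blocks (one idle wire after the front window). [folklore] -/
def base (n : ℕ) : ℕ := b P n + 1

/-- Wire `i` of block `j`. [folklore] -/
def blk (n j i : ℕ) : ℕ := base P n + j * b P n + i

/-- The total number of wires. [folklore] -/
def W (n : ℕ) : ℕ := base P n + K P n * b P n

/-- The number of ancillas. [folklore] -/
def anc (n : ℕ) : ℕ := W P n - n

/-! ### Size bookkeeping -/

section Sizes

variable {P}

/-- `0 < K n`. [folklore] -/
theorem K_pos (n : ℕ) : 0 < K P n := Nat.succ_pos _

/-- `2 ≤ b n`. [folklore] -/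
theorem two_le_b (n : ℕ) : 2 ≤ b P n := by unfold b; omega

/-- `0 < b n`. [folklore] -/
theorem b_pos (n : ℕ) : 0 < b P n := lt_of_lt_of_le Nat.zero_lt_two (two_le_b n)

/-- `n + 2 ≤ b n`. [folklore] -/
theorem add_two_le_b (n : ℕ) : n + 2 ≤ b P n := by unfold b; omega

/-- The copy fits into a block: `n + F.ancillas n ≤ b n`. [folklore] -/
theorem copy_fits (n : ℕ) : n + P.F.ancillas n ≤ b P n := by
  have := P.hpF n; unfold b; omega

/-- `b n < base n`. [folklore] -/
theorem b_lt_base (n : ℕ) : b P n < base P n := by unfold base; omega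

/-- `base n ≤ W n`. [folklore] -/
theorem base_le_W (n : ℕ) : base P n ≤ W P n := by unfold W; exact Nat.le_add_right _ _

/-- `blk n 0 0 = base n`. [folklore] -/
theorem blk_zero_zero (n : ℕ) : blk P n 0 0 = base P n := by unfold blk; simp

/-- `blk n j i = blk n j 0 + i`. [folklore] -/
theorem blk_eq_add (n j i : ℕ) : blk P n j i = blk P n j 0 + i := by unfold blk; omega

/-- Wires of block `j < K n` are below `W`. [folklore] -/
theorem blk_lt_W {n j i : ℕ} (hj : j < K P n) (hi : i < b P n) : blk P n j i < W P n := by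
  unfold blk W
  have : j * b P n + i < K P n * b P n := by
    calc j * b P n + i < j * b P n + b P n := by omega
      _ = (j + 1) * b P n := by ring
      _ ≤ K P n * b P n := Nat.mul_le_mul_right _ hj
  omega

/-- Blocks are disjoint: equal wires have equal block and offset. [folklore] -/
theorem blk_inj {n j i j' i' : ℕ} (hi : i < b P n) (hi' : i' < b P n) (h : blk P n j i = blk P n j' i') :
    j = j' ∧ i = i' := by
  unfold blk at h
  have h1 : j * b P n + i = j' * b P n + i' := by omega
  have hj : j = j' := by nlinarith
  subst hj
  exact ⟨rfl, by omega⟩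

/-- `base ≤ blk`. [folklore] -/
theorem base_le_blk (n j i : ℕ) : base P n ≤ blk P n j i := by unfold blk; omega

/-- `n ≤ W n`. [folklore] -/
theorem le_W (n : ℕ) : n ≤ W P n :=
  ((Nat.le_add_right n 2).trans (add_two_le_b n)).trans ((b_lt_base n).le.trans (base_le_W n))

/-- **`n + anc n = W n`.** [folklore] -/
theorem n_add_anc (n : ℕ) : n + anc P n = W P n := by have := le_W (P := P) n; unfold anc; omega

/-- There is a wire. [folklore] -/
theorem width_pos (n : ℕ) : 0 < n + anc P n := by
  rw [n_add_anc]; exact lt_of_lt_of_le (lt_of_lt_of_le (by norm_num) (two_le_b n)) ((b_lt_base n).le.trans (base_le_W n))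

/-- `base < W` (there is a block). [folklore] -/
theorem base_lt_W (n : ℕ) : base P n < W P n := by
  have h := blk_lt_W (P := P) (n := n) (j := 0) (i := 0) (K_pos n) (b_pos n)
  rwa [blk_zero_zero] at h

end Sizes

/-! ### The programs -/

/-- **Stage 1: fan-out of the input** into the input wires of every block ("write out `k` copies
of the input", BBBV step 2). [cite: BennettBernsteinBrassardVazirani1997, Thm. 4.13 (proof, step 2)] -/
def prog1 (n : ℕ) : List (ClOp ℕ) :=
  (List.range (K P n)).flatMap fun j => (List.range n).map fun i => ClOp.cnot i (blk P n j i)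

/-- The pairs (front wire `i`, wire `i` of block `j`), `i < b n`. [folklore] -/
def conjPairs (n j : ℕ) : List (ℕ × ℕ) := (List.range (b P n)).map fun i => (i, blk P n j i)

/-- **The conjugating swap of block `j` with the front window.** [cite: NielsenChuang2010, §1.3.4 (swap from three CNOTs)] -/
def progConj (n j : ℕ) : List (ClOp ℕ) := swapOps (conjPairs P n j)

/-! ### Well-formedness and wire bounds -/

section WF

variable {P}

/-- Membership in `prog1`. [folklore] -/
theorem mem_prog1 {n : ℕ} {op : ClOp ℕ} : op ∈ prog1 P n ↔ ∃ j < K P n, ∃ i < n, op = ClOp.cnot i (blk P n j i) := by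
  simp only [prog1, List.mem_flatMap, List.mem_range, List.mem_map]
  constructor
  · rintro ⟨j, hj, i, hi, rfl⟩; exact ⟨j, hj, i, hi, rfl⟩
  · rintro ⟨j, hj, i, hi, rfl⟩; exact ⟨j, hj, i, hi, rfl⟩

/-- `prog1` is well formed. [folklore] -/
theorem prog1_wf (n : ℕ) : ∀ op ∈ prog1 P n, op.WF := by
  intro op hop
  obtain ⟨j, -, i, hi, rfl⟩ := mem_prog1.1 hop
  have : i < base P n := lt_of_lt_of_le hi ((Nat.le_add_right n 2).trans ((add_two_le_b n).trans (b_lt_base n).le))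
  exact Nat.ne_of_lt (lt_of_lt_of_le this (base_le_blk n j i))

/-- `progConj` is well formed. [folklore] -/
theorem progConj_wf (n j : ℕ) : ∀ op ∈ progConj P n j, op.WF := by
  refine swapOps_wf fun p hp => ?_
  simp only [conjPairs, List.mem_map, List.mem_range] at hp
  obtain ⟨i, hi, rfl⟩ := hp
  exact Nat.ne_of_lt (lt_of_lt_of_le hi ((b_lt_base n).le.trans (base_le_blk n j i)))

/-- `prog1` uses wires below `W`. [folklore] -/
theorem prog1_lt (n : ℕ) : ∀ op ∈ prog1 P n, ∀ p ∈ wiresOf op, p < W P n := by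
  intro op hop p hp
  obtain ⟨j, hj, i, hi, rfl⟩ := mem_prog1.1 hop
  simp only [mem_wiresOf, ClOp.target, ClOp.controls, List.mem_singleton] at hp
  rcases hp with rfl | rfl
  · exact blk_lt_W hj (lt_of_lt_of_le hi ((Nat.le_add_right n 2).trans (add_two_le_b n)))
  · exact lt_of_lt_of_le hi (le_W n)

/-- `progConj n j`, `j < K n`, uses wires below `W`. [folklore] -/
theorem progConj_lt {n j : ℕ} (hj : j < K P n) : ∀ op ∈ progConj P n j, ∀ p ∈ wiresOf op, p < W P n := by
  intro op hop p hp
  obtain ⟨q, hq, h⟩ := CWrap.wiresOf_swapOps hop p hp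
  simp only [conjPairs, List.mem_map, List.mem_range] at hq
  obtain ⟨i, hi, rfl⟩ := hq
  rcases h with rfl | rfl
  · exact lt_of_lt_of_le hi ((b_lt_base n).le.trans (base_le_W n))
  · exact blk_lt_W hj hi

end WF

/-! ### Semantics of stage 1 -/

section Stage1

/-- **The assignment after stage 1** on the input `x` (`PostBQPAmp.inp x`: `x` followed by zeros).
[folklore] -/
def w1 (x : List Bool) : ℕ → Bool := clEval (prog1 P x.length) (PostBQPAmp.inp x)

variable {P}

/-- Targets of `prog1` are never controls of `prog1`. [folklore] -/
theorem prog1_disjoint (n : ℕ) : ∀ op ∈ prog1 P n, ∀ op' ∈ prog1 P n, op'.target ∉ op.controls := by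
  intro op hop op' hop'
  obtain ⟨j, -, i, hi, rfl⟩ := mem_prog1.1 hop
  obtain ⟨j', -, i', -, rfl⟩ := mem_prog1.1 hop'
  simp only [ClOp.target, ClOp.controls, List.mem_singleton]
  intro h
  have h1 := base_le_blk (P := P) n j' i'
  have h2 : i < base P n := lt_of_lt_of_le hi ((Nat.le_add_right n 2).trans ((add_two_le_b n).trans (b_lt_base n).le))
  omega

/-- `prog1` does not touch wires that are not block input wires. [folklore] -/
theorem clEval_prog1_of_ne (n : ℕ) (w : ℕ → Bool) {p : ℕ} (hp : ∀ j < K P n, ∀ i < n, p ≠ blk P n j i) :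
    clEval (prog1 P n) w p = w p :=
  clEval_apply_of_forall_target_ne _ _ fun op hop e => by
    obtain ⟨j, hj, i, hi, rfl⟩ := mem_prog1.1 hop
    exact hp j hj i hi e.symm

/-- `prog1` does not touch wires below `base`. [folklore] -/
theorem clEval_prog1_of_lt_base (n : ℕ) (w : ℕ → Bool) {p : ℕ} (hp : p < base P n) : clEval (prog1 P n) w p = w p :=
  clEval_prog1_of_ne n w fun j _ i _ e => absurd (base_le_blk (P := P) n j i) (by rw [← e]; exact Nat.not_le.2 hp)

/-- **`prog1` XORs input wire `i` into wire `i` of every block.** [cite: NielsenChuang2010, §1.3.4 (CNOT copies classical bits)] -/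
theorem clEval_prog1_blk (n : ℕ) (w : ℕ → Bool) {j i : ℕ} (hj : j < K P n) (hi : i < n) :
    clEval (prog1 P n) w (blk P n j i) = (w (blk P n j i) ^^ w i) := by
  have hib : ∀ i, i < n → i < b P n := fun i hi => lt_of_lt_of_le hi ((Nat.le_add_right n 2).trans (add_two_le_b n))
  rw [clEval_apply_of_disjoint _ (prog1_disjoint n)]
  congr 1
  unfold prog1
  rw [clToggle_flatMap_of_forall_ne (List.range (K P n)) _ w (blk P n j i) j List.nodup_range (List.mem_range.2 hj) ?_]
  · have hmem : ClOp.cnot i (blk P n j i) ∈ (List.range n).map fun i => ClOp.cnot i (blk P n j i) :=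
      List.mem_map.2 ⟨i, List.mem_range.2 hi, rfl⟩
    have h := clToggle_eq_guard_of_nodup ((List.range n).map fun i => ClOp.cnot i (blk P n j i)) w ?_ hmem
    · simpa [ClOp.target, ClOp.guard] using h
    · rw [List.map_map]
      exact List.nodup_range.map_on fun a _ c _ h => by
        simp only [Function.comp_apply, ClOp.target] at h
        unfold blk at h; omega
  · intro j' _ hne op hop
    obtain ⟨i', hi', rfl⟩ := List.mem_map.1 hop
    simp only [ClOp.target]
    intro e
    exact hne (blk_inj (hib i' (List.mem_range.1 hi')) (hib i hi) e).1

/-- Below `base`, stage 1 keeps the input: `x` followed by zeros. [folklore] -/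
theorem w1_of_lt_base (x : List Bool) {p : ℕ} (hp : p < base P x.length) : w1 P x p = PostBQPAmp.inp x p :=
  clEval_prog1_of_lt_base _ _ hp

/-- Data wires keep `x`. [folklore] -/
theorem w1_of_lt (x : List Bool) {p : ℕ} (hp : p < x.length) : w1 P x p = x.getD p false :=
  w1_of_lt_base x (lt_of_lt_of_le hp (((Nat.le_add_right _ 2).trans (add_two_le_b _)).trans (b_lt_base _).le))

/-- Wires in `[|x|, base)` are `0` after stage 1. [folklore] -/
theorem w1_of_le_of_lt_base (x : List Bool) {p : ℕ} (hp : x.length ≤ p) (hp' : p < base P x.length) : w1 P x p = false := by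
  rw [w1_of_lt_base x hp']; exact PostBQPAmp.inp_of_le x hp

/-- **The input wires of every block hold `x`.** [cite: NielsenChuang2010, §1.3.4 (CNOT copies classical bits)] -/
theorem w1_blk_of_lt (x : List Bool) {j i : ℕ} (hj : j < K P x.length) (hi : i < x.length) :
    w1 P x (blk P x.length j i) = x.getD i false := by
  unfold w1
  rw [clEval_prog1_blk _ _ hj hi, PostBQPAmp.inp_of_le x ((((Nat.le_add_right _ 2).trans (add_two_le_b _)).trans (b_lt_base _).le).trans
    (base_le_blk _ j i)), Bool.false_xor]
  rfl

/-- The other wires of every block are `0`. [folklore] -/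
theorem w1_blk_of_le (x : List Bool) {j i : ℕ} (hi : x.length ≤ i) (hib : i < b P x.length) :
    w1 P x (blk P x.length j i) = false := by
  unfold w1
  rw [clEval_prog1_of_ne _ _ (fun j' _ i' hi' e => ?_)]
  · exact PostBQPAmp.inp_of_le x ((((Nat.le_add_right _ 2).trans (add_two_le_b _)).trans (b_lt_base _).le).trans (base_le_blk _ j i))
  · have := (blk_inj hib (lt_of_lt_of_le hi' (((Nat.le_add_right _ 2).trans (add_two_le_b _)))) e).2
    omega

/-- Everything from `W` on is `0` after stage 1. [folklore] -/
theorem w1_of_W_le (x : List Bool) {p : ℕ} (hp : W P x.length ≤ p) : w1 P x p = false := by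
  unfold w1
  rw [clEval_prog1_of_ne _ _ (fun j hj i hi e => ?_)]
  · exact PostBQPAmp.inp_of_le x ((le_W _).trans hp)
  · have := blk_lt_W (P := P) hj (lt_of_lt_of_le hi ((Nat.le_add_right _ 2).trans (add_two_le_b _)))
    omega

end Stage1

/-! ## Part II. The circuits, the family, and the matrices of the stages -/

section Compile

variable {P}

/-- `prog1` fits. [folklore] -/
theorem prog1_lt' (n : ℕ) : ∀ op ∈ prog1 P n, ∀ i ∈ wiresOf op, i < n + anc P n := by
  rw [n_add_anc]; exact prog1_lt n

/-- `progConj n j` fits (for `j < K n`). [folklore] -/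
theorem progConj_lt' {n j : ℕ} (hj : j < K P n) : ∀ op ∈ progConj P n j, ∀ i ∈ wiresOf op, i < n + anc P n := by
  rw [n_add_anc]; exact progConj_lt hj

/-- The copy fits into the register. [folklore] -/
theorem copy_fits' (n : ℕ) : n + P.F.ancillas n ≤ n + anc P n := by
  rw [n_add_anc]; exact (copy_fits n).trans ((b_lt_base n).le.trans (base_le_W n))

/-- The front window fits into the register. [folklore] -/
theorem b_fits (n : ℕ) : b P n ≤ n + anc P n := by
  rw [n_add_anc]; exact (b_lt_base n).le.trans (base_le_W n)

variable (P)

/-- A program over `ℕ` with wires below `n + anc n`, re-indexed to `Fin (n + anc n)` and turned into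
reversible operations. [cite: AroraBarak2009, §10.3.7 Lemma 10.10] -/
def clamp (n : ℕ) (ops : List (ClOp ℕ)) (hlt : ∀ op ∈ ops, ∀ i ∈ wiresOf op, i < n + anc P n)
    (hwf : ∀ op ∈ ops, op.WF) : List (RevOp (n + anc P n)) :=
  toRevList (ops.map (ClOp.map (finOf (n + anc P n) (width_pos n)))) fun op hop => by
    simp only [List.mem_map] at hop
    obtain ⟨op, hop, rfl⟩ := hop
    exact wf_map_finOf _ (hlt op hop) (hwf op hop)

/-- **Semantics of a clamped program**: the `ℕ`-program on the lifted assignment. [folklore] -/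
theorem revEval_clamp (n : ℕ) (ops : List (ClOp ℕ)) (hlt : ∀ op ∈ ops, ∀ i ∈ wiresOf op, i < n + anc P n)
    (hwf : ∀ op ∈ ops, op.WF) (w : QReg (n + anc P n)) (p : Fin (n + anc P n)) :
    revEval (clamp P n ops hlt hwf) w p = clEval ops (liftW w) p := by
  unfold clamp
  rw [revEval_toRevList, clEval_map_finOf_apply _ ops hlt]

/-- Stage 1, compiled. [folklore] -/
def stage1 (n : ℕ) : List (QGate cliffordT (n + anc P n)) :=
  revCompile (clamp P n (prog1 P n) (prog1_lt' n) (prog1_wf n))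

/-- **The conjugating swap of block `j`**, compiled (empty for `j ≥ K n`). [cite: NielsenChuang2010, §1.3.4 (swap from three CNOTs)] -/
def conjGates (n j : ℕ) : List (QGate cliffordT (n + anc P n)) :=
  if h : j < K P n then revCompile (clamp P n (progConj P n j) (progConj_lt' h) (progConj_wf n j)) else []

/-- **The copy**: `F.circ n` on the front wires, verbatim. [cite: AroraBarak2009, §6.2 (a circuit for each input length, hard-wired)] -/
def copyGates (n : ℕ) : List (QGate cliffordT (n + anc P n)) :=
  (mapWires (Fin.castLEEmb (copy_fits' n)) (P.F.circ n)).gates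

/-- The quantum stage: for every `j < K n`, swap, copy, swap back ("loop `k` times on a machine
that runs `M`", BBBV step 3). [cite: BennettBernsteinBrassardVazirani1997, Thm. 4.13 (proof, step 3)] -/
def stageQ (n : ℕ) : List (QGate cliffordT (n + anc P n)) :=
  (List.range (K P n)).flatMap fun j => conjGates P n j ++ (copyGates P n ++ conjGates P n j)

/-- **The circuit of the `K(n)`-copy family on inputs of length `n`.** [cite: BennettBernsteinBrassardVazirani1997, Thm. 4.13 (proof)] -/
def circ (n : ℕ) : QCircuit cliffordT (n + anc P n) := ⟨stage1 P n ++ stageQ P n⟩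

/-- **The `K(n)`-copy family.** [cite: BennettBernsteinBrassardVazirani1997, Thm. 4.13 (k independent copies of M)] -/
def family : QCircuitFamily cliffordT := ⟨anc P, circ P⟩

/-- The circuit of the family (definitional). [folklore] -/
@[simp] theorem family_circ (n : ℕ) : (family P).circ n = circ P n := rfl

/-- The ancillas of the family (definitional). [folklore] -/
@[simp] theorem family_ancillas (n : ℕ) : (family P).ancillas n = anc P n := rfl

/-- **The family is oracle-free** (if the given one is). [folklore] -/
theorem family_isOracleFree (hF : P.F.IsOracleFree) : (family P).IsOracleFree := by
  intro n g hg
  have hg' : g ∈ stage1 P n ++ stageQ P n := hg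
  rcases List.mem_append.1 hg' with h | h
  · exact revCompile_isOracleFree (clamp P n (prog1 P n) (prog1_lt' n) (prog1_wf n)) g h
  · obtain ⟨j, -, h⟩ := List.mem_flatMap.1 h
    have hconj : g ∈ conjGates P n j → g.IsOracleFree := fun h => by
      unfold conjGates at h
      split_ifs at h with hj
      · exact revCompile_isOracleFree (clamp P n (progConj P n j) (progConj_lt' hj) (progConj_wf n j)) g h
      · exact absurd h List.not_mem_nil
    rcases List.mem_append.1 h with h | h
    · exact hconj h
    rcases List.mem_append.1 h with h | h
    · exact isOracleFree_mapWires _ (hF n) g h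
    · exact hconj h

end Compile

/-! ### Stage 1 on the input -/

section Stage1Matrix

/-- The basis label after stage 1 on the input `x`. [folklore] -/
def W1 (x : List Bool) : QReg (x.length + anc P x.length) := fun p => w1 P x p

variable {P}

/-- **Stage 1 on a basis state.** [cite: AroraBarak2009, §10.3.7 Lemma 10.10] -/
theorem toMatrix_stage1_mulVec_basisState (A : Language Bool) (n : ℕ) (w : QReg (n + anc P n)) :
    (⟨stage1 P n⟩ : QCircuit cliffordT (n + anc P n)).toMatrix A *ᵥ basisState w =
      basisState (fun p => clEval (prog1 P n) (liftW w) p) := by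
  rw [stage1, revCompile_mulVec_basisState]
  congr 1
  funext p
  exact revEval_clamp P n _ _ _ w p

/-- **Stage 1 on the input `|x 0…0⟩` yields `|w1 x⟩`.** [cite: AroraBarak2009, §10.3.7 Lemma 10.10] -/
theorem toMatrix_stage1_mulVec_pad (A : Language Bool) (x : List Bool) :
    (⟨stage1 P x.length⟩ : QCircuit cliffordT (x.length + anc P x.length)).toMatrix A *ᵥ
        basisState (padInput x.get (anc P x.length)) = basisState (W1 P x) := by
  rw [toMatrix_stage1_mulVec_basisState, PostBQPAmp.liftW_padInput_get]
  rfl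

end Stage1Matrix

/-! ### The conjugating swap -/

section Conj

variable {P} {n j : ℕ} (hj : j < K P n)

include hj in
/-- Block wires fit. [folklore] -/
theorem blk_fits {i : ℕ} (hi : i < b P n) : blk P n j i < n + anc P n := by
  rw [n_add_anc]; exact blk_lt_W hj hi

/-- **The wire involution of the conjugating swap**: front wire `i < b n` ↔ wire `i` of block `j`,
all other wires fixed. [cite: NielsenChuang2010, §1.3.4 (swap from three CNOTs)] -/
def conjInvol (hj : j < K P n) (p : Fin (n + anc P n)) : Fin (n + anc P n) :=
  if h1 : (p : ℕ) < b P n then ⟨blk P n j p, blk_fits hj h1⟩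
  else if h2 : blk P n j 0 ≤ p ∧ (p : ℕ) < blk P n j 0 + b P n then
    ⟨p - blk P n j 0, by have := p.isLt; omega⟩
  else p

/-- `conjInvol` on a front wire. [folklore] -/
theorem conjInvol_of_lt {p : Fin (n + anc P n)} (hp : (p : ℕ) < b P n) : (conjInvol hj p : ℕ) = blk P n j p := by
  unfold conjInvol; rw [dif_pos hp]

/-- `conjInvol` on a block wire. [folklore] -/
theorem conjInvol_blk {i : ℕ} (hi : i < b P n) : (conjInvol hj ⟨blk P n j i, blk_fits hj hi⟩ : ℕ) = i := by
  have h1 : ¬ blk P n j i < b P n := Nat.not_lt.2 ((b_lt_base n).le.trans (base_le_blk n j i))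
  have h2 : blk P n j 0 ≤ blk P n j i ∧ blk P n j i < blk P n j 0 + b P n := by rw [blk_eq_add n j i]; omega
  unfold conjInvol
  rw [dif_neg h1, dif_pos h2]
  simp [blk_eq_add n j i]

/-- `conjInvol` elsewhere. [folklore] -/
theorem conjInvol_of_not {p : Fin (n + anc P n)} (hp : ¬ (p : ℕ) < b P n)
    (hp' : ¬ (blk P n j 0 ≤ p ∧ (p : ℕ) < blk P n j 0 + b P n)) : conjInvol hj p = p := by
  unfold conjInvol; rw [dif_neg hp, dif_neg hp']

/-- **`conjInvol` is an involution.** [folklore] -/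
theorem conjInvol_conjInvol (p : Fin (n + anc P n)) : conjInvol hj (conjInvol hj p) = p := by
  have hb := (b_lt_base (P := P) n).le.trans (base_le_blk n j 0)
  by_cases h1 : (p : ℕ) < b P n
  · have e : conjInvol hj p = ⟨blk P n j p, blk_fits hj h1⟩ := by unfold conjInvol; rw [dif_pos h1]
    rw [e]
    exact Fin.ext (conjInvol_blk hj h1)
  · by_cases h2 : blk P n j 0 ≤ p ∧ (p : ℕ) < blk P n j 0 + b P n
    · have hi : (p : ℕ) - blk P n j 0 < b P n := by omega
      have e : conjInvol hj p = ⟨p - blk P n j 0, by have := p.isLt; omega⟩ := by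
        unfold conjInvol; rw [dif_neg h1, dif_pos h2]
      rw [e]
      apply Fin.ext
      rw [conjInvol_of_lt hj (by exact hi)]
      simp only
      rw [blk_eq_add n j]; omega
    · rw [conjInvol_of_not hj h1 h2, conjInvol_of_not hj h1 h2]

/-- **The compiled conjugating swap permutes basis states along `conjInvol`.** [cite: NielsenChuang2010, §1.3.4 (swap from three CNOTs)] -/
theorem toMatrix_conjGates_mulVec_basisState (A : Language Bool) (w : QReg (n + anc P n)) :
    (⟨conjGates P n j⟩ : QCircuit cliffordT (n + anc P n)).toMatrix A *ᵥ basisState w = basisState (w ∘ conjInvol hj) := by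
  unfold conjGates
  rw [dif_pos hj, revCompile_mulVec_basisState]
  congr 1
  funext p
  rw [revEval_clamp]
  unfold progConj
  have hb := (b_lt_base (P := P) n).le.trans (base_le_blk n j 0)
  have h1 : ((conjPairs P n j).map Prod.fst).Nodup := by
    rw [conjPairs, List.map_map]; simpa [Function.comp_def] using List.nodup_range
  have h2 : ((conjPairs P n j).map Prod.snd).Nodup := by
    rw [conjPairs, List.map_map]
    exact List.nodup_range.map_on fun a _ c _ h => by simp only [Function.comp_apply] at h; unfold blk at h; omega
  have h12 : ∀ q ∈ conjPairs P n j, ∀ q' ∈ conjPairs P n j, q.1 ≠ q'.2 := by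
    intro q hq q' hq'
    simp only [conjPairs, List.mem_map, List.mem_range] at hq hq'
    obtain ⟨i, hi, rfl⟩ := hq; obtain ⟨i', -, rfl⟩ := hq'
    exact Nat.ne_of_lt (lt_of_lt_of_le hi ((b_lt_base n).le.trans (base_le_blk n j i')))
  obtain ⟨hsnd, hfst, hother⟩ := clEval_swapOps (conjPairs P n j) h1 h2 h12 (liftW w)
  simp only [Function.comp_apply]
  by_cases hp : (p : ℕ) < b P n
  · have hmem : ((p : ℕ), blk P n j p) ∈ conjPairs P n j := List.mem_map.2 ⟨p, List.mem_range.2 hp, rfl⟩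
    rw [hfst _ hmem]
    change liftW w (blk P n j p) = w (conjInvol hj p)
    rw [← liftW_val w (conjInvol hj p), conjInvol_of_lt hj hp]
  · by_cases hp2 : blk P n j 0 ≤ p ∧ (p : ℕ) < blk P n j 0 + b P n
    · have hi : (p : ℕ) - blk P n j 0 < b P n := by omega
      have hpe : (p : ℕ) = blk P n j (p - blk P n j 0) := by rw [blk_eq_add n j]; omega
      have hmem : ((p : ℕ) - blk P n j 0, (p : ℕ)) ∈ conjPairs P n j :=
        List.mem_map.2 ⟨_, List.mem_range.2 hi, by rw [← hpe]⟩
      rw [hsnd _ hmem]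
      change liftW w ((p : ℕ) - blk P n j 0) = w (conjInvol hj p)
      rw [← liftW_val w (conjInvol hj p)]
      congr 1
      unfold conjInvol; rw [dif_neg hp, dif_pos hp2]
    · rw [hother _ (fun q hq => ?_), conjInvol_of_not hj hp hp2, liftW_val]
      simp only [conjPairs, List.mem_map, List.mem_range] at hq
      obtain ⟨i, hi, rfl⟩ := hq
      refine ⟨fun h => hp (h ▸ hi), fun h => hp2 ?_⟩
      rw [h, blk_eq_add n j i]; omega

/-- **Swap–copy–swap computes the copy transported along `conjInvol`.** [cite: NielsenChuang2010, §4.3 (a gate on a subset of the wires is U ⊗ 1 up to the order of the factors)] -/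
theorem toMatrix_conjBlock (A : Language Bool) :
    (⟨conjGates P n j ++ (copyGates P n ++ conjGates P n j)⟩ : QCircuit cliffordT (n + anc P n)).toMatrix A =
      (mapWires ((Fin.castLEEmb (copy_fits' n)).trans (invEmb (conjInvol hj) (conjInvol_conjInvol hj))) (P.F.circ n)).toMatrix A :=
  toMatrix_conj_mapWires A (conjInvol hj) (conjInvol_conjInvol hj) (conjGates P n j)
    (toMatrix_conjGates_mulVec_basisState hj A) (Fin.castLEEmb (copy_fits' n)) (P.F.circ n)

end Conj

/-! ### The blocks and the quantum stage -/

section Blocks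

variable (n : ℕ)

/-- Block `j` as an embedding of `b n` wires. [folklore] -/
def blockEmb (j : Fin (K P n)) : Fin (b P n) ↪ Fin (n + anc P n) :=
  ⟨fun i => ⟨blk P n j i, blk_fits j.isLt i.isLt⟩, fun _ _ h => Fin.ext (blk_inj (P := P) (Fin.isLt _) (Fin.isLt _) (congrArg Fin.val h)).2⟩

/-- The copy, padded to the block width. [folklore] -/
def Cpad : QCircuit cliffordT (b P n) := mapWires (Fin.castLEEmb (copy_fits n)) (P.F.circ n)

variable {P n}

/-- `blockEmb` evaluated. [folklore] -/
@[simp] theorem blockEmb_apply_val (j : Fin (K P n)) (i : Fin (b P n)) : (blockEmb P n j i : ℕ) = blk P n j i := rfl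

/-- **The blocks are pairwise disjoint.** [folklore] -/
theorem blockDisjoint : BlockDisjoint (blockEmb P n) := by
  intro j j' hne
  refine Set.disjoint_left.2 ?_
  rintro w ⟨i, rfl⟩ ⟨i', hi'⟩
  have h := congrArg Fin.val hi'
  simp only [blockEmb_apply_val] at h
  exact hne (Fin.ext (blk_inj i'.isLt i.isLt h).1).symm

/-- Off the blocks means below `base`. [folklore] -/
theorem offBlocks_iff (w : Fin (n + anc P n)) : OffBlocks (blockEmb P n) w ↔ (w : ℕ) < base P n := by
  constructor
  · intro h
    by_contra hlt
    push Not at hlt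
    have hB : 0 < b P n := b_pos n
    have hw : (w : ℕ) < W P n := by rw [← n_add_anc]; exact w.isLt
    set d := (w : ℕ) - base P n with hd
    have hdlt : d < K P n * b P n := by unfold W at hw; omega
    have hjlt : d / b P n < K P n := (Nat.div_lt_iff_lt_mul hB).2 hdlt
    have hilt : d % b P n < b P n := Nat.mod_lt _ hB
    refine h ⟨d / b P n, hjlt⟩ ⟨⟨d % b P n, hilt⟩, Fin.ext ?_⟩
    simp only [blockEmb_apply_val]
    unfold blk
    have := Nat.div_add_mod d (b P n)
    rw [Nat.mul_comm] at this
    omega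
  · rintro hw j ⟨i, rfl⟩
    exact absurd (base_le_blk (P := P) n j i) (Nat.not_le.2 hw)

/-- Swap–copy–swap of block `j` is the padded copy embedded on block `j`, matrix-wise. [folklore] -/
theorem toMatrix_conjBlock_eq (A : Language Bool) (j : Fin (K P n)) :
    (⟨conjGates P n j ++ (copyGates P n ++ conjGates P n j)⟩ : QCircuit cliffordT (n + anc P n)).toMatrix A =
      (mapWires (blockEmb P n j) (Cpad P n)).toMatrix A := by
  rw [toMatrix_conjBlock j.isLt, toMatrix_mapWires, Cpad, toMatrix_mapWires, toMatrix_mapWires, placeGate_placeGate]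
  congr 1
  ext i
  simp only [Function.Embedding.trans_apply, Fin.castLEEmb_apply, blockEmb_apply_val, Fin.val_castLE, invEmb_apply]
  exact conjInvol_of_lt j.isLt (lt_of_lt_of_le i.isLt (copy_fits n))

/-- **The quantum stage is the product of the padded copies on the blocks, matrix-wise.**
[cite: NielsenChuang2010, §4.3 (a gate on a subset of the wires is U ⊗ 1 up to the order of the factors)] -/
theorem toMatrix_stageQ (A : Language Bool) :
    (⟨stageQ P n⟩ : QCircuit cliffordT (n + anc P n)).toMatrix A =
      (⟨(List.finRange (K P n)).flatMap fun j => (mapWires (blockEmb P n j) (Cpad P n)).gates⟩ :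
        QCircuit cliffordT (n + anc P n)).toMatrix A := by
  have hl : stageQ P n = (List.finRange (K P n)).flatMap fun j : Fin _ =>
      conjGates P n j ++ (copyGates P n ++ conjGates P n j) := by
    rw [stageQ, ← List.map_coe_finRange_eq_range, List.flatMap_map]
  rw [hl]
  exact toMatrix_flatMap_congr A _ _ _ fun j _ => toMatrix_conjBlock_eq A j

variable (P) (x : List Bool)

/-- The padded input, padded further to the block width: `x`, `0^{F.ancillas |x|}`, zeros. [folklore] -/
def padBlock : QReg (b P x.length) :=
  padInput (padInput x.get (P.F.ancillas x.length)) (b P x.length - (x.length + P.F.ancillas x.length)) ∘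
    Fin.cast (Nat.add_sub_cancel' (copy_fits x.length)).symm

/-- The block state after the quantum stage (the same for every block). [folklore] -/
def blockState : QReg (b P x.length) → ℂ := (Cpad P x.length).toMatrix 0 *ᵥ basisState (padBlock P x)

variable {P x}

/-- `padBlock` on a data wire. [folklore] -/
theorem padBlock_of_lt (i : Fin (b P x.length)) (hi : (i : ℕ) < x.length) : padBlock P x i = x.get ⟨i, hi⟩ := by
  have e1 : Fin.cast (Nat.add_sub_cancel' (copy_fits x.length)).symm i =
      Fin.castAdd (b P x.length - (x.length + P.F.ancillas x.length)) (Fin.castAdd (P.F.ancillas x.length) ⟨i, hi⟩) := Fin.ext rfl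
  simp only [padBlock, Function.comp_apply]
  rw [e1, padInput, Fin.append_left, padInput, Fin.append_left]

/-- `padBlock` beyond the data wires is `0`. [folklore] -/
theorem padBlock_of_le (i : Fin (b P x.length)) (hi : x.length ≤ (i : ℕ)) : padBlock P x i = false := by
  simp only [padBlock, Function.comp_apply]
  by_cases hi2 : (i : ℕ) < x.length + P.F.ancillas x.length
  · have e1 : Fin.cast (Nat.add_sub_cancel' (copy_fits x.length)).symm i =
        Fin.castAdd (b P x.length - (x.length + P.F.ancillas x.length))
          (Fin.natAdd x.length ⟨i - x.length, by omega⟩) := Fin.ext (by simp; omega)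
    rw [e1, padInput, Fin.append_left, padInput, Fin.append_right]
  · have e1 : Fin.cast (Nat.add_sub_cancel' (copy_fits x.length)).symm i =
        Fin.natAdd (x.length + P.F.ancillas x.length) ⟨i - (x.length + P.F.ancillas x.length), by have := i.isLt; omega⟩ :=
      Fin.ext (by simp; omega)
    rw [e1, padInput, Fin.append_right]

/-- Restricting `padBlock` to the copy gives the padded input of the copy. [folklore] -/
theorem padBlock_comp_castLE : padBlock P x ∘ Fin.castLEEmb (copy_fits x.length) = padInput x.get (P.F.ancillas x.length) := by
  funext i
  simp only [Function.comp_apply]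
  by_cases hi : (i : ℕ) < x.length
  · rw [padBlock_of_lt _ (by exact hi)]
    have e : i = Fin.castAdd (P.F.ancillas x.length) ⟨i, hi⟩ := Fin.ext rfl
    conv_rhs => rw [e, padInput, Fin.append_left]
    rfl
  · rw [padBlock_of_le _ (by exact Nat.not_lt.1 hi)]
    have e : i = Fin.natAdd x.length ⟨i - x.length, by have := i.isLt; omega⟩ := Fin.ext (by simp; omega)
    conv_rhs => rw [e, padInput, Fin.append_right]

/-- **The content of every block after stage 1 is the padded input.** [folklore] -/
theorem W1_comp_blockEmb (j : Fin (K P x.length)) : W1 P x ∘ blockEmb P x.length j = padBlock P x := by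
  funext i
  simp only [Function.comp_apply, W1]
  change w1 P x (blk P x.length j i) = _
  by_cases hi : (i : ℕ) < x.length
  · rw [w1_blk_of_lt x j.isLt hi, padBlock_of_lt i hi, List.getD_eq_getElem _ _ hi]
    rfl
  · rw [w1_blk_of_le x (Nat.not_lt.1 hi) i.isLt, padBlock_of_le i (Nat.not_lt.1 hi)]

/-- **The state after the quantum stage is the product state of the block states** (off the blocks:
`w1 x`). [cite: NielsenChuang2010, §2.1.7 eq. (2.45)] -/
theorem stageQ_mulVec_W1 :
    (⟨stageQ P x.length⟩ : QCircuit cliffordT (x.length + anc P x.length)).toMatrix 0 *ᵥ basisState (W1 P x) =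
      prodState (blockEmb P x.length) (fun _ => blockState P x) (W1 P x) := by
  rw [toMatrix_stageQ, basisState_eq_prodState (blockEmb P x.length) (W1 P x),
    toMatrix_flatMap_mapWires_mulVec_prodState 0 blockDisjoint]
  congr 1
  funext j
  rw [W1_comp_blockEmb j]
  rfl

/-- **The final state is the product state.** [folklore] -/
theorem runOn_circ (x : List Bool) :
    (circ P x.length).runOn 0 (basisState (padInput x.get (anc P x.length))) =
      prodState (blockEmb P x.length) (fun _ => blockState P x) (W1 P x) := by
  rw [QCircuit.runOn, circ, show (⟨stage1 P x.length ++ stageQ P x.length⟩ : QCircuit cliffordT (x.length + anc P x.length)) =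
      (⟨stage1 P x.length⟩ : QCircuit cliffordT _).append ⟨stageQ P x.length⟩ from rfl, QCircuit.toMatrix_append,
    ← Matrix.mulVec_mulVec, toMatrix_stage1_mulVec_pad, stageQ_mulVec_W1]

end Blocks

/-! ## Part III. The output law: answer wires of the copies -/

section Law

variable {P}

/-- The answer wire of copy `j` as a wire of the register. [folklore] -/
def ansW (n : ℕ) (j : Fin (K P n)) : Fin (n + anc P n) := ⟨blk P n j 0, blk_fits j.isLt (b_pos n)⟩

/-- `ansW` is wire `0` of block `j`. [folklore] -/
theorem blockEmb_zero (n : ℕ) (j : Fin (K P n)) : blockEmb P n j ⟨0, b_pos n⟩ = ansW n j := rfl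

/-- The measured string at the answer position of copy `j`. [folklore] -/
theorem getD_ofFn_ansW (n : ℕ) (z : QReg (n + anc P n)) (j : Fin (K P n)) :
    (List.ofFn z).getD (blk P n j 0) false = z (ansW n j) := by
  have hlt : blk P n j 0 < n + anc P n := (ansW n j).isLt
  rw [List.getD_eq_getElem?_getD, List.getElem?_ofFn, dif_pos hlt, Option.getD_some]
  rfl

/-- **The output kernel of the `K(n)`-copy family is the Born sum of the product state.**
[cite: NielsenChuang2010, §2.2.5 (Born rule)] -/
theorem kernelProb_family_eq (x : List Bool) (E : Set (List Bool)) [DecidablePred (· ∈ E)] :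
    (family P).kernelProb 0 x E = ∑ z : QReg (x.length + anc P x.length),
      if List.ofFn z ∈ E then ‖prodState (blockEmb P x.length) (fun _ => blockState P x) (W1 P x) z‖ ^ 2 else 0 := by
  change ((((circ P x.length).outputPMF 0 x.get).map List.ofFn).toOuterMeasure E).toReal = _
  rw [toReal_outputPMF_map_ofFn, runOn_circ]

/-- **Every block state is a unit vector.** [cite: NielsenChuang2010, §2.2.5 (normalisation)] -/
theorem sum_normSq_blockState (x : List Bool) : ∑ v, ‖blockState P x v‖ ^ 2 = 1 := by
  have h := normSq_mulVec_of_mem_unitaryGroup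
    (QCircuit.toMatrix_mem_unitaryGroup_holds cliffordT_isUnitary_holds 0 (Cpad P x.length)) (basisState (padBlock P x))
  rw [normSq_basisState] at h
  exact h

/-- **The one-block marginal of "the answer wire reads `1`" is the acceptance probability of the
given family** (also on the empty register, where both vanish). [cite: NielsenChuang2010, §2.2.8 (measurement of one register of a product state)] -/
theorem sum_filter_blockState_wire0 (x : List Bool) :
    (∑ v ∈ univ.filter (fun v : QReg (b P x.length) => v ⟨0, b_pos x.length⟩ = true), ‖blockState P x v‖ ^ 2) =
      P.F.acceptProbOn 0 x := by
  classical
  rw [Finset.sum_filter]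
  by_cases hk : 0 < x.length + P.F.ancillas x.length
  · have hT : ∀ v : QReg (b P x.length), (v ⟨0, b_pos x.length⟩ = true) ↔
        ((v ∘ Fin.castLEEmb (copy_fits x.length)) ⟨0, hk⟩ = true) := fun v => Iff.rfl
    simp only [blockState, Cpad, toMatrix_mapWires]
    rw [show (∑ v : QReg (b P x.length), if v ⟨0, b_pos x.length⟩ = true then
        ‖(placeGate (Fin.castLEEmb (copy_fits x.length)) ((P.F.circ x.length).toMatrix 0) *ᵥ basisState (padBlock P x)) v‖ ^ 2 else 0) =
          ∑ v : QReg (b P x.length), if ((v ∘ Fin.castLEEmb (copy_fits x.length)) ⟨0, hk⟩ = true) then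
            ‖(placeGate (Fin.castLEEmb (copy_fits x.length)) ((P.F.circ x.length).toMatrix 0) *ᵥ basisState (padBlock P x)) v‖ ^ 2 else 0
      from Finset.sum_congr rfl fun v _ => by simp only [hT]]
    rw [sum_normSq_placeGate_castLE (copy_fits x.length) ((P.F.circ x.length).toMatrix 0) (padBlock P x)
      (fun u : QReg (x.length + P.F.ancillas x.length) => u ⟨0, hk⟩ = true), padBlock_comp_castLE]
    unfold QCircuitFamily.acceptProbOn QCircuit.acceptProb
    refine Finset.sum_congr rfl fun u _ => ?_
    simp only [hk, dif_pos, QCircuit.runOn, mulVec_basisState]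
  · have hk0 : x.length + P.F.ancillas x.length = 0 := by omega
    unfold QCircuitFamily.acceptProbOn QCircuit.acceptProb
    trans (0 : ℝ)
    · refine Finset.sum_eq_zero fun v _ => ?_
      split_ifs with hv
      · simp only [blockState, Cpad, toMatrix_mapWires]
        rw [placeGate_castLE_mulVec_basisState (copy_fits x.length) _ (padBlock P x) (fun i hi => padBlock_of_le i (by omega)),
          if_neg (fun h => ?_)]
        · simp
        · have := h ⟨0, b_pos x.length⟩ (by simp [hk0])
          rw [hv] at this
          exact Bool.noConfusion this
      · rfl
    · symm
      exact Finset.sum_eq_zero fun u _ => by rw [dif_neg hk]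

/-- The one-block marginal of "the answer wire reads `0`" is the rejection probability. [cite: NielsenChuang2010, §2.2.8 (measurement of one register of a product state)] -/
theorem sum_filter_blockState_wire0_false (x : List Bool) :
    (∑ v ∈ univ.filter (fun v : QReg (b P x.length) => v ⟨0, b_pos x.length⟩ = false), ‖blockState P x v‖ ^ 2) =
      1 - P.F.acceptProbOn 0 x := by
  classical
  rw [← sum_filter_blockState_wire0, ← sum_normSq_blockState (P := P) x, eq_sub_iff_add_eq,
    ← Finset.sum_filter_add_sum_filter_not univ (fun v : QReg (b P x.length) => v ⟨0, b_pos x.length⟩ = false)]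
  congr 1
  exact Finset.sum_congr (Finset.filter_congr fun v _ => by simp) fun _ _ => rfl

/-- **Read-out events decided by a strict majority of correct answers are likely.** If `E` contains
every measured string in which the copies answering `c` are a strict majority, and one copy answers
`c` with probability at least `1/2 + η`, then the `K(n)`-copy family outputs a string in `E` with
probability at least `1 − 1/(4 K(n) η²)` ("just like taking the majority of `k` independent coin
flips", weighted Chebyshev bound). [cite: BennettBernsteinBrassardVazirani1997, Thm. 4.13 (proof)] -/
theorem kernelProb_ge_of_majority (x : List Bool) (c : Bool) {η : ℝ} (hη : 0 < η)
    (hgood : 1 / 2 + η ≤ ∑ v ∈ univ.filter (fun v : QReg (b P x.length) => v ⟨0, b_pos x.length⟩ = c), ‖blockState P x v‖ ^ 2)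
    (E : Set (List Bool)) [DecidablePred (· ∈ E)]
    (hE : ∀ z : QReg (x.length + anc P x.length),
      ¬ 2 * (univ.filter fun j : Fin (K P x.length) => z (ansW x.length j) = c).card ≤ K P x.length → List.ofFn z ∈ E) :
    1 - 1 / (4 * K P x.length * η ^ 2) ≤ (family P).kernelProb 0 x E := by
  classical
  rw [kernelProb_family_eq]
  set w : QReg (b P x.length) → ℝ := fun v => ‖blockState P x v‖ ^ 2 with hw
  set good : QReg (b P x.length) → Prop := fun v => v ⟨0, b_pos x.length⟩ = c with hgooddef
  set fail : (Fin (K P x.length) → QReg (b P x.length)) → Prop :=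
    fun y => 2 * (univ.filter fun j => good (y j)).card ≤ K P x.length with hfail
  have hw0 : ∀ v, 0 ≤ w v := fun v => by positivity
  have hw1 : ∑ v, w v = 1 := sum_normSq_blockState x
  have hcheb := sum_majority_fail_mul_le w hw0 hw1 good (K_pos (P := P) x.length) hη hgood
  have hpos : (0 : ℝ) < 4 * K P x.length * η ^ 2 := by have := K_pos (P := P) x.length; positivity
  have hfailSum : (∑ y ∈ univ.filter fail, ∏ j, w (y j)) ≤ 1 / (4 * K P x.length * η ^ 2) := by
    rw [le_div_iff₀ hpos]; exact hcheb
  have htot : (∑ y : Fin (K P x.length) → QReg (b P x.length), ∏ j, w (y j)) = 1 := by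
    have e := Finset.prod_univ_sum (fun _ : Fin (K P x.length) => (univ : Finset (QReg (b P x.length)))) (fun _ v => w v)
    simp only [Fintype.piFinset_univ] at e
    rw [← e, hw1, Finset.prod_const_one]
  have hterm : ∀ z : QReg (x.length + anc P x.length),
      ‖prodState (blockEmb P x.length) (fun _ => blockState P x) (W1 P x) z‖ ^ 2 *
          (1 - if fail (fun j => z ∘ blockEmb P x.length j) then 1 else 0) ≤
        (if List.ofFn z ∈ E then ‖prodState (blockEmb P x.length) (fun _ => blockState P x) (W1 P x) z‖ ^ 2 else 0) := by
    intro z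
    by_cases hf : fail (fun j => z ∘ blockEmb P x.length j)
    · rw [if_pos hf, sub_self, mul_zero]
      split_ifs <;> positivity
    · rw [if_neg hf, sub_zero, mul_one, if_pos]
      refine hE z ?_
      simpa only [hfail, hgooddef, Function.comp_apply, blockEmb_zero] using hf
  calc 1 - 1 / (4 * K P x.length * η ^ 2)
      ≤ 1 - ∑ y ∈ univ.filter fail, ∏ j, w (y j) := by linarith
    _ = ∑ y : Fin (K P x.length) → QReg (b P x.length), (∏ j, w (y j)) * (1 - if fail y then 1 else 0) := by
        have e : ∀ y : Fin (K P x.length) → QReg (b P x.length), (∏ j, w (y j)) * (1 - if fail y then 1 else 0) =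
            (∏ j, w (y j)) - (if fail y then ∏ j, w (y j) else 0) := fun y => by
          split_ifs <;> ring
        simp only [e, Finset.sum_sub_distrib, htot, Finset.sum_filter]
    _ = ∑ z : QReg (x.length + anc P x.length),
          ‖prodState (blockEmb P x.length) (fun _ => blockState P x) (W1 P x) z‖ ^ 2 *
            (1 - if fail (fun j => z ∘ blockEmb P x.length j) then 1 else 0) :=
        (sum_normSq_prodState_mul blockDisjoint (fun _ => blockState P x) (W1 P x) (fun y => 1 - if fail y then 1 else 0)).symm
    _ ≤ _ := Finset.sum_le_sum fun z _ => hterm z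

/-- **Yes-instances.** [cite: BennettBernsteinBrassardVazirani1997, Thm. 4.13 (proof)] -/
theorem kernelProb_ge_of_majority_true (x : List Bool) {η : ℝ} (hη : 0 < η) (hx : 1 / 2 + η ≤ P.F.acceptProbOn 0 x)
    (E : Set (List Bool)) [DecidablePred (· ∈ E)]
    (hE : ∀ z : QReg (x.length + anc P x.length),
      ¬ 2 * (univ.filter fun j : Fin (K P x.length) => z (ansW x.length j) = true).card ≤ K P x.length → List.ofFn z ∈ E) :
    1 - 1 / (4 * K P x.length * η ^ 2) ≤ (family P).kernelProb 0 x E :=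
  kernelProb_ge_of_majority x true hη (by rw [sum_filter_blockState_wire0]; exact hx) E hE

/-- **No-instances.** [cite: BennettBernsteinBrassardVazirani1997, Thm. 4.13 (proof)] -/
theorem kernelProb_ge_of_majority_false (x : List Bool) {η : ℝ} (hη : 0 < η) (hx : P.F.acceptProbOn 0 x ≤ 1 / 2 - η)
    (E : Set (List Bool)) [DecidablePred (· ∈ E)]
    (hE : ∀ z : QReg (x.length + anc P x.length),
      ¬ 2 * (univ.filter fun j : Fin (K P x.length) => z (ansW x.length j) = false).card ≤ K P x.length → List.ofFn z ∈ E) :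
    1 - 1 / (4 * K P x.length * η ^ 2) ≤ (family P).kernelProb 0 x E :=
  kernelProb_ge_of_majority x false hη (by rw [sum_filter_blockState_wire0_false]; linarith) E hE

end Law

/-! ## Part IV. The `K(n)`-copy family is uniform

By `QCircuitFamily.isUniform_of_descFn_mem_FP` it suffices that the description
`1ⁿ ↦ ⟨bin n, ⟨1^{anc n}, encode (circ n)⟩⟩` is in `FP`; `encode (circ n)` is the concatenation of the
description bits of stage 1 (a generator program with two nested loops, `gen1`, the outer bound being
the counter expression `pK(n) + 1`) and, for every `j < K n`, of "swap (`SwapDesc.swapDescFn` at the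
binary offset `base n + j · b n`), the description of `F.circ n` verbatim (the body of
`F.descFn ∈ FP`), swap", folded over `j` by the counted concatenation fold of `FoldBricks.lean` with a
ruler bounding the pieces (the pattern of `CWrapUniform.sqF`, here with `K(n)` rounds)
(Arora–Barak 2009, §6.2 and Remark 6.7: descriptions printed with counters). -/

section Uniform

open Polynomial Complexity.Brick Plumb RevDesc RevClean Complexity.GExpr

/-! ### Stage descriptions are program descriptions -/

section Desc

variable {P}

/-- The description bits of a clamped compiled program are the `opBits` of the program.
[cite: AroraBarak2009, §6.1 (descriptions of circuits)] -/
theorem flatMap_gateEnc_clamp (n : ℕ) (ops : List (ClOp ℕ)) (hlt : ∀ op ∈ ops, ∀ i ∈ wiresOf op, i < n + anc P n)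
    (hwf : ∀ op ∈ ops, op.WF) :
    (revCompile (clamp P n ops hlt hwf)).flatMap gateEnc = ops.flatMap opBits :=
  flatMap_gateEnc_revCompile_toRevList (width_pos n) ops hlt _

/-- Stage 1 describes as `prog1`. [folklore] -/
theorem flatMap_gateEnc_stage1 (n : ℕ) : (stage1 P n).flatMap gateEnc = (prog1 P n).flatMap opBits :=
  flatMap_gateEnc_clamp n _ _ _

/-- The conjugating swap describes as `progConj` (for `j < K n`). [folklore] -/
theorem flatMap_gateEnc_conjGates {n j : ℕ} (hj : j < K P n) :
    (conjGates P n j).flatMap gateEnc = (progConj P n j).flatMap opBits := by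
  unfold conjGates; rw [dif_pos hj]; exact flatMap_gateEnc_clamp n _ _ _

/-- The copy describes as the given circuit, verbatim. [cite: AroraBarak2009, §6.2 (a circuit for each input length, hard-wired)] -/
theorem flatMap_gateEnc_copyGates (n : ℕ) : (copyGates P n).flatMap gateEnc = (P.F.circ n).encode := by
  unfold copyGates
  rw [show (P.F.circ n).encode = QCircuit.encode (⟨(P.F.circ n).gates⟩ : QCircuit cliffordT _) from rfl, encode_eq_flatMap]
  simp only [mapWires, List.flatMap_map, CWrap.gateEnc_mapWiresGate_castLEEmb]

end Desc

/-! ### The layout as counter expressions and as polynomials -/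

/-- The number of copies `K` as an expression in the input length `uu`. [folklore] -/
def KE : GE := .add (CWrap.polyE P.pK (.var .uu)) (.const 1)

/-- The block width `b` as an expression. [folklore] -/
def bE : GE := .add (.add (.var .uu) (CWrap.polyE P.pF (.var .uu))) (.const 2)

/-- The first block wire `base` as an expression. [folklore] -/
def baseE : GE := .add (bE P) (.const 1)

/-- Wire `i` of block `j` as an expression transformer. [folklore] -/
def blkE (jE iE : GE) : GE := .add (.add (baseE P) (.mul jE (bE P))) iE

/-- `K(n)` as a polynomial. [folklore] -/
def KPoly : Polynomial ℕ := P.pK + 1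

/-- `b(n)` as a polynomial. [folklore] -/
def bPoly : Polynomial ℕ := X + P.pF + C 2

/-- `base(n)` as a polynomial. [folklore] -/
def basePoly : Polynomial ℕ := bPoly P + 1

/-- `W(n)` as a polynomial. [folklore] -/
def WPoly : Polynomial ℕ := basePoly P + KPoly P * bPoly P

variable {P}

/-- Value of `KE`. [folklore] -/
@[simp] theorem eval_KE (env : GV → ℕ) : (KE P).eval env = K P (env .uu) := by simp [KE, GExpr.eval, K]

/-- Value of `bE`. [folklore] -/
@[simp] theorem eval_bE (env : GV → ℕ) : (bE P).eval env = b P (env .uu) := by simp [bE, GExpr.eval, b]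

/-- Value of `baseE`. [folklore] -/
@[simp] theorem eval_baseE (env : GV → ℕ) : (baseE P).eval env = base P (env .uu) := by simp [baseE, GExpr.eval, base]

/-- Value of `blkE`. [folklore] -/
@[simp] theorem eval_blkE (jE iE : GE) (env : GV → ℕ) : (blkE P jE iE).eval env = blk P (env .uu) (jE.eval env) (iE.eval env) := by
  simp [blkE, GExpr.eval, blk]

/-- Value of `KPoly`. [folklore] -/
@[simp] theorem eval_KPoly (n : ℕ) : (KPoly P).eval n = K P n := by simp [KPoly, K]

/-- Value of `bPoly`. [folklore] -/
@[simp] theorem eval_bPoly (n : ℕ) : (bPoly P).eval n = b P n := by simp [bPoly, b]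

/-- Value of `basePoly`. [folklore] -/
@[simp] theorem eval_basePoly (n : ℕ) : (basePoly P).eval n = base P n := by simp [basePoly, base]

/-- Value of `WPoly`. [folklore] -/
@[simp] theorem eval_WPoly (n : ℕ) : (WPoly P).eval n = W P n := by simp [WPoly, W]

/-! ### Stage 1: a generator with two nested loops -/

variable (P)

/-- **Generator of stage 1**: `for j < K n, for i < n: CNOT i (blk j i)`. [cite: AroraBarak2009, §6.2 (descriptions printed with counters)] -/
def gen1 : GS :=
  GStmt.loop .jj (KE P) (GStmt.loop .tt (.var .uu) (opsG [ClOp.cnot (.var .tt) (blkE P (.var .jj) (.var .tt))]))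

variable {P}

/-- **The stage-1 generator prints `prog1`.** [folklore] -/
theorem out_gen1 (env : GV → ℕ) : (gen1 P).out env = (prog1 P (env .uu)).flatMap opToks := by
  have hut : ∀ k k', Function.update (Function.update env GV.jj k) GV.tt k' GV.uu = env GV.uu := fun k k' => by
    rw [Function.update_of_ne (by decide), Function.update_of_ne (by decide)]
  have hutj : ∀ k k', Function.update (Function.update env GV.jj k) GV.tt k' GV.jj = k := fun k k' => by
    rw [Function.update_of_ne (by decide), Function.update_self]
  have huj : ∀ k, Function.update env GV.jj k GV.uu = env GV.uu := fun k => Function.update_of_ne (by decide) _ _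
  simp only [gen1, GStmt.out, out_opsG, List.map_cons, List.map_nil, ClOp.map, GExpr.eval, Function.update_self, hut, hutj,
    huj, eval_blkE, eval_KE, List.flatMap_cons, List.flatMap_nil, List.append_nil, prog1, List.flatMap_assoc, List.flatMap_map]

/-- `uu` is not a loop variable of the stage-1 generator. [folklore] -/
theorem uu_notMem_loopVars_gen1 : GV.uu ∉ (gen1 P).loopVars := by
  intro h
  simp only [gen1, GStmt.loopVars, List.mem_cons] at h
  rcases h with h | h | h
  · exact absurd h (by decide)
  · exact absurd h (by decide)
  · exact absurd (loopVars_opsG_sub _ _ h) (by decide)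

/-- Non-reuse of the stage-1 generator. [folklore] -/
theorem noReuse_gen1 : (gen1 P).noReuse = true :=
  noReuse_loop_of (lv_loop (P := (· ≠ GV.jj)) (by decide) (lv_opsG (by decide) _))
    (noReuse_loop_of (lv_opsG (by decide) _) (noReuse_opsG _))

/-- **Stage 1 describes in polynomial time.** [cite: AroraBarak2009, §6.2 Def. 6.12 and Remark 6.7 (descriptions printed in polynomial time)] -/
theorem stage1_desc_mem_FP : (fun z : List Bool => (stage1 P z.length).flatMap gateEnc) ∈ FP := by
  have h := GStmt.render_out_mem_FP (gen1 P) GV.uu uu_notMem_loopVars_gen1 noReuse_gen1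
  refine (congrArg (· ∈ FP) (funext fun z => ?_)).mpr h
  rw [out_gen1, RevClean.render_flatMap_opToks_nil, GenProg.initEnv_self, flatMap_gateEnc_stage1]

/-! ### The quantum stage: a counted fold of swap–copy–swap pieces -/

section StageQ

variable (P)

/-- The context field of the piece: `z = 1ⁿ` (as `⟨⟨z, ruler⟩, 1ʲ⟩ ↦ z`). [folklore] -/
def zOf : List Bool → List Bool := fstF ∘ fstF

/-- The swap piece: the description of the swap of the front window with block `j`, from
`⟨⟨1ⁿ, ruler⟩, 1ʲ⟩` (offset `base n + j · b n` in binary, `1^{b n}`). [folklore] -/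
def swF : List Bool → List Bool :=
  SwapDesc.swapDescFn ∘ fanoutFn
    (addFn ∘ fanoutFn (lenBinF ∘ polyFn (basePoly P) ∘ zOf)
      (prodFn ∘ fanoutFn (lenBinF ∘ sndF) (lenBinF ∘ polyFn (bPoly P) ∘ zOf)))
    (polyFn (bPoly P) ∘ zOf)

/-- The copy piece: the body of the given family's description at `1ⁿ`. [folklore] -/
def copyF : List Bool → List Bool := sndF ∘ sndF ∘ P.F.descFn ∘ zOf

/-- The piece of index `j`: swap, copy, swap. [folklore] -/
def pieceQ : List Bool → List Bool := appF ∘ fanoutFn (swF P) (appF ∘ fanoutFn (copyF P) (swF P))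

variable {P}

/-- `swF` computes the description of the conjugating swap. [folklore] -/
theorem swF_apply (z r : List Bool) (j : ℕ) :
    swF P (boolPair (boolPair z r) (ones j)) = (progConj P z.length j).flatMap opBits := by
  have h : swF P (boolPair (boolPair z r) (ones j)) =
      SwapDesc.swapDescFn (boolPair (encodeNat (base P z.length + j * b P z.length)) (ones (b P z.length))) := by
    simp [swF, zOf, fanoutFn_apply, ones]
  rw [h, SwapDesc.swapDescFn_apply]
  rfl

/-- `copyF` computes the description of the copy. [folklore] -/
theorem copyF_apply (z r : List Bool) (j : ℕ) :
    copyF P (boolPair (boolPair z r) (ones j)) = (copyGates P z.length).flatMap gateEnc := by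
  rw [flatMap_gateEnc_copyGates, copyF]
  simp only [Function.comp_apply, zOf, fstF_boolPair, CWrap.sndF_sndF_descFn]

/-- The piece of index `j < K n` is the description of swap–copy–swap. [folklore] -/
theorem pieceQ_apply (z r : List Bool) {j : ℕ} (hj : j < K P z.length) :
    pieceQ P (boolPair (boolPair z r) (ones j)) =
      (conjGates P z.length j ++ (copyGates P z.length ++ conjGates P z.length j)).flatMap gateEnc := by
  rw [List.flatMap_append, List.flatMap_append, flatMap_gateEnc_conjGates hj, ← copyF_apply z r j, ← swF_apply z r j]
  simp [pieceQ, fanoutFn_apply]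

/-- `swF ∈ FP`. [folklore] -/
theorem swF_mem_FP : swF P ∈ FP := by
  have hz : zOf ∈ FP := comp_mem_FP fstF_mem_FP fstF_mem_FP
  exact comp_mem_FP SwapDesc.swapDescFn_mem_FP (fanoutFn_mem_FP
    (comp_mem_FP addFn_mem_FP (fanoutFn_mem_FP (comp_mem_FP lenBinF_mem_FP (comp_mem_FP (polyFn_mem_FP _) hz))
      (comp_mem_FP prodFn_mem_FP (fanoutFn_mem_FP (comp_mem_FP lenBinF_mem_FP sndF_mem_FP)
        (comp_mem_FP lenBinF_mem_FP (comp_mem_FP (polyFn_mem_FP _) hz))))))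
    (comp_mem_FP (polyFn_mem_FP _) hz))

/-- `copyF ∈ FP` for a uniform family. [folklore] -/
theorem copyF_mem_FP (hU : P.F.IsUniform) : copyF P ∈ FP :=
  comp_mem_FP sndF_mem_FP (comp_mem_FP sndF_mem_FP (comp_mem_FP (QCircuitFamily.descFn_mem_FP_of_isUniform hU)
    (comp_mem_FP fstF_mem_FP fstF_mem_FP)))

/-- `pieceQ ∈ FP` for a uniform family. [folklore] -/
theorem pieceQ_mem_FP (hU : P.F.IsUniform) : pieceQ P ∈ FP :=
  comp_mem_FP appF_mem_FP (fanoutFn_mem_FP swF_mem_FP (comp_mem_FP appF_mem_FP (fanoutFn_mem_FP (copyF_mem_FP hU) swF_mem_FP)))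

variable (P) (ps pd : Polynomial ℕ)

/-- The ruler polynomial: room for the rounds and for every piece. [folklore] -/
def rulerPoly : Polynomial ℕ :=
  KPoly P + (C 2 * ps.comp (C 2 * WPoly P + C 2 + bPoly P) + pd)

/-- The initial record of the fold: `⟨⟨z, ruler⟩, ⟨bin (K n), ⟨1⁰, []⟩⟩⟩`. [folklore] -/
def initQ : List Bool → List Bool :=
  fanoutFn (fanoutFn (fun z => z) (polyFn (rulerPoly P ps pd))) (fanoutFn (lenBinF ∘ polyFn (KPoly P)) (fun _ => boolPair [] []))

/-- **The description of the quantum stage** as a string function: fold the pieces `j < K n`.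
[cite: AroraBarak2009, §1.3 (bounded loops)] -/
def sqF : List Bool → List Bool := sndPow 2 ∘ foldLoop appF (clipF 1 (pieceQ P)) X ∘ initQ P ps pd

variable {P}

/-- `sqF ∈ FP`. [folklore] -/
theorem sqF_mem_FP (hU : P.F.IsUniform) : sqF P ps pd ∈ FP :=
  comp_mem_FP (sndPow_mem_FP 2) (comp_mem_FP (foldLoop_clipF_mem_FP 1 appF_mem_FP length_appF_le (pieceQ_mem_FP hU) X)
    (fanoutFn_mem_FP (fanoutFn_mem_FP (PolyTimeComputable.id _) (polyFn_mem_FP _))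
      (fanoutFn_mem_FP (comp_mem_FP lenBinF_mem_FP (polyFn_mem_FP _)) (const_mem_FP _))))

/-- **The fold computes the description of the quantum stage**, provided the ruler bounds the
pieces: `|swapDescFn v| ≤ ps |v|` and `|descFn u| ≤ pd |u|`. [folklore] -/
theorem sqF_apply (hps : ∀ v, (SwapDesc.swapDescFn v).length ≤ ps.eval v.length)
    (hpd : ∀ u, (P.F.descFn u).length ≤ pd.eval u.length) (z : List Bool) :
    sqF P ps pd z = (stageQ P z.length).flatMap gateEnc := by
  set n := z.length with hn
  set ctx := boolPair z (ones ((rulerPoly P ps pd).eval n)) with hctx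
  have hinit : initQ P ps pd z = boolPair ctx (boolPair (encodeNat (K P n)) (boolPair (ones 0) [])) := by
    simp [initQ, fanoutFn_apply, hctx, hn, ones]
  have hrounds : K P n ≤ (X : Polynomial ℕ).eval ctx.length := by
    rw [eval_X, hctx, length_boolPair]
    have : K P n ≤ (rulerPoly P ps pd).eval n := by simp [rulerPoly]
    simp [ones]; omega
  -- the pieces are within the ruler
  have hpiece : ∀ j, 0 ≤ j → j < 0 + K P n → (pieceQ P (boolPair ctx (ones j))).length ≤ 1 * (ctx.length + 1) := by
    intro j _ hj
    have hjK : j < K P n := by omega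
    rw [hctx, pieceQ_apply z _ (by rw [← hn]; exact hjK), List.flatMap_append, List.flatMap_append, List.length_append,
      List.length_append, flatMap_gateEnc_conjGates (by rw [← hn]; exact hjK), flatMap_gateEnc_copyGates, ← hn]
    -- the swap part
    have hsw : ((progConj P n j).flatMap opBits).length ≤ ps.eval (2 * W P n + 2 + b P n) := by
      rw [← swF_apply z (ones ((rulerPoly P ps pd).eval n)) j]
      have h := hps (boolPair (encodeNat (base P n + j * b P n)) (ones (b P n)))
      have e : swF P (boolPair (boolPair z (ones ((rulerPoly P ps pd).eval n))) (ones j)) =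
          SwapDesc.swapDescFn (boolPair (encodeNat (base P n + j * b P n)) (ones (b P n))) := by
        simp [swF, zOf, fanoutFn_apply, ones, hn]
      rw [e]
      refine h.trans (TM2Iter.eval_mono ps ?_)
      rw [length_boolPair]
      have hb : (encodeNat (base P n + j * b P n)).length ≤ W P n := by
        refine (Complexity.length_encodeNat_le_self _).trans ?_
        have h4 : j * b P n ≤ K P n * b P n := Nat.mul_le_mul_right _ hjK.le
        unfold W; omega
      simp [ones]; omega
    -- the copy part
    have hcp : (P.F.circ n).encode.length ≤ pd.eval n := by
      have h := hpd z
      rw [QCircuitFamily.descFn_eq, length_boolPair, length_boolPair, ← hn] at h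
      omega
    rw [length_boolPair]
    have hr : (rulerPoly P ps pd).eval n = K P n + (2 * ps.eval (2 * W P n + 2 + b P n) + pd.eval n) := by
      simp [rulerPoly]
    simp only [ones, List.length_replicate, one_mul]
    omega
  rw [sqF, Function.comp_apply, Function.comp_apply, hinit, foldLoop_apply appF (clipF 1 (pieceQ P)) hrounds 0 [],
    sndPow_succ_boolPair, sndPow_succ_boolPair, sndPow_zero_boolPair, foldAcc_clipF hpiece, foldAcc_appF, List.nil_append,
    stageQ, List.flatMap_assoc, CWrap.flatMap_range_eq_ccat]
  refine ccat_congr fun j hj => ?_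
  rw [Nat.zero_add, hctx, pieceQ_apply z _ (by rw [← hn]; omega), ← hn]

end StageQ

/-! ### The header and the assembly -/

variable (P)

/-- The ancilla count in unary: `1^{W n}` with the first `n` symbols dropped. [folklore] -/
def ancF : List Bool → List Bool := dropFn ∘ fanoutFn (fun z => z) (polyFn (WPoly P))

variable {P}

/-- Value of `ancF`. [folklore] -/
theorem ancF_apply (z : List Bool) : ancF P z = unaryEncodeNat (anc P z.length) := by
  simp only [ancF, Function.comp_apply, fanoutFn_apply, dropFn_boolPair, polyFn_apply, eval_WPoly, ones, List.drop_replicate, anc]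
  exact (RevDesc.unaryEncodeNat_eq_replicate _).symm

/-- `ancF ∈ FP`. [folklore] -/
theorem ancF_mem_FP : ancF P ∈ FP := comp_mem_FP dropFn_mem_FP (fanoutFn_mem_FP (PolyTimeComputable.id _) (polyFn_mem_FP _))

variable (P)

/-- **The `K(n)`-copy family is polynomial-time uniform** (if the given family is). [cite: AroraBarak2009, §6.2 Def. 6.12 and Remark 6.7 (descriptions printed in polynomial time)] -/
theorem family_isUniform (hU : P.F.IsUniform) : (family P).IsUniform := by
  obtain ⟨ps, hps⟩ := exists_poly_length_le_of_mem_FP SwapDesc.swapDescFn_mem_FP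
  obtain ⟨pd, hpd⟩ := exists_poly_length_le_of_mem_FP (QCircuitFamily.descFn_mem_FP_of_isUniform hU)
  refine QCircuitFamily.isUniform_of_descFn_mem_FP ?_
  have h := fanoutFn_mem_FP lenBinF_mem_FP (fanoutFn_mem_FP (ancF_mem_FP (P := P))
    (append_mem_FP (stage1_desc_mem_FP (P := P)) (sqF_mem_FP ps pd hU)))
  have e : (family P).descFn = fanoutFn lenBinF (fanoutFn (ancF P)
      (fun z => (stage1 P z.length).flatMap gateEnc ++ sqF P ps pd z)) := by
    funext z
    have henc : (circ P z.length).encode = (stage1 P z.length ++ stageQ P z.length).flatMap gateEnc := by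
      unfold circ; exact encode_eq_flatMap _
    rw [fanoutFn_apply, fanoutFn_apply, lenBinF_apply, ancF_apply, sqF_apply ps pd hps hpd, QCircuitFamily.descFn_eq]
    dsimp only [family_circ, family_ancillas]
    rw [henc, List.flatMap_append]
  rw [e]
  exact h

end Uniform

end PolyCopies

end Literature.Computability.QuantumComplexity

end
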